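import Summits.AtomisticToContinuum.Crystallization.Theorems.FrustratedLawDichotomyLocalDischargingRule

/-!
# FrustratedLawDichotomy · MOTIF LEMMAS for the motif door (capped fit predicate, extension from a deep sub-cluster, agreement of site quantities)

Part A of the motif door beneath `…LocalDischargingRule` (hand-2 g12, critic row 487 (2a)); part B `…MotifDoor` assembles the door.

* §1 `GoodAtScale η D y i` — the two-shell fit predicate `GoodAt η` WITH ITS SCALE CAPPED, `d ≤ D` (text of `GoodAt` with `d ≤ D ∧` inserted);
  `goodAtScale_iff : GoodAtScale η D y i ↔ GoodAt η y i ∧ nearestDist y i ≤ D` (injective `y`; `scale_eq_nearestDist`: the fit scale IS `nn_i`).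
  Capping the scale is what makes the good-site CREDIT local: a site good at a huge scale (dilated crystal) is simply not credited.
* §2 `clauses_extend` / ★ `goodAt_of_motif` — a capped-good centre of a DEEP sub-cluster (`z = y ∘ φ` containing every atom of `y` within `ϱ` of the
  centre, `13/10·D + 1 ≤ ϱ`) is good in the cluster (sub-cluster twin of `…LocalCloseOrderFinite.robustGood_of_deep`, clean gap capped at `1`).
* §3 agreement of the three site quantities between the cluster and the motif of a site: `truncSum_motif` (`R ≤ ϱ`), `nearestDist_motif` /
  `densityProxy_motif` (another atom within `ϱ`), `netInflow_motif` (rule of range `R′` and locality `ρ`, `R′ + ρ ≤ ϱ`: `HasRange` + `IsLocal`),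
  and `rhs_ge_of_isolated` (no other atom within `ϱ ≥ max (R, R′, 1)`: right-hand side `≥ −A`).

[folklore] bookkeeping; 0 sorry.  Prover hand 2, gen 12 (decomp-a2c), `--supports stmt-AtomisticToContinuum-27623`.
-/

noncomputable section

namespace Summit.AtomisticToContinuum.Crystallization.Theorems.FrustratedLawDichotomyMotifLemmas

open scoped BigOperators Classical
open Literature.MathematicalPhysics.StatisticalMechanics (interactionEnergy lennardJones)
open Literature.Geometry.DiscreteGeometry (nearestDist nearestDist_le_dist le_nearestDist exists_nearestDist_eq_dist
  nearestDist_eq_zero_of_subsingleton nearestDist_nonneg)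
open Summit.AtomisticToContinuum.Crystallization.Theorems.ChargedEnergyGapNegative (E3 eStar)
open Summit.AtomisticToContinuum.Crystallization.Theorems.FrustratedLawDichotomyRangeCut
open Summit.AtomisticToContinuum.Crystallization.Theorems.FrustratedLawDichotomyTailFloor (tailFloor_holds tailFloor_seven_324)
open Summit.AtomisticToContinuum.Crystallization.Theorems.FrustratedLawDichotomyLocalPricing
open Summit.AtomisticToContinuum.Crystallization.Theorems.FrustratedLawDichotomyLocalDischargingRule

/-! ## §1. `GoodAtScale`: the fit predicate with its scale capped -/

/-- **`GoodAtScale η D y i`** — `GoodAt η y i` with the fit scale `d` (the site's nearest-neighbour distance) CAPPED by `D`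
(the text of `GoodAt` with `d ≤ D ∧` inserted in both branches). -/
def GoodAtScale (ηmax D : ℝ) {N : ℕ} (y : Fin N → EuclideanSpace ℝ (Fin 3)) (i : Fin N) : Prop :=
  ∃ (d η γ : ℝ) (A : EuclideanSpace ℝ (Fin 3) →ₗᵢ[ℝ] EuclideanSpace ℝ (Fin 3)), d ≤ D ∧ ((∃ t : ↥Literature.Geometry.DiscreteGeometry.fccKissingPattern → EuclideanSpace ℝ (Fin 3), 0 < d ∧ 0 < γ ∧ η < ηmax ∧ (∀ u : ↥Literature.Geometry.DiscreteGeometry.fccKissingPattern, t u ∈ (Set.range y) ∧ ‖(t u - (y i)) - d • A (u : EuclideanSpace ℝ (Fin 3))‖ ≤ η * d) ∧ (∀ s : EuclideanSpace ℝ (Fin 3), s ∈ (Set.range y) → s ≠ (y i) → d ≤ dist s (y i)) ∧ (∃ s : EuclideanSpace ℝ (Fin 3), s ∈ (Set.range y) ∧ s ≠ (y i) ∧ dist s (y i) ≤ d) ∧ (∀ s : EuclideanSpace ℝ (Fin 3), s ∈ (Set.range y) → s ≠ (y i) → dist s (y i) < 13 / 10 * d + γ → dist s (y i) ≤ 13 /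 10 * d - γ ∧ s ∈ Set.range t)) ∨ (∃ t : ↥Literature.Geometry.DiscreteGeometry.hcpKissingPattern → EuclideanSpace ℝ (Fin 3), 0 < d ∧ 0 < γ ∧ η < ηmax ∧ (∀ u : ↥Literature.Geometry.DiscreteGeometry.hcpKissingPattern, t u ∈ (Set.range y) ∧ ‖(t u - (y i)) - d • A (u : EuclideanSpace ℝ (Fin 3))‖ ≤ η * d) ∧ (∀ s : EuclideanSpace ℝ (Fin 3), s ∈ (Set.range y) → s ≠ (y i) → d ≤ dist s (y i)) ∧ (∃ s : EuclideanSpace ℝ (Fin 3), s ∈ (Set.range y) ∧ s ≠ (y i) ∧ dist s (y i) ≤ d) ∧ (∀ s : EuclideanSpace ℝ (Fin 3), s ∈ (Set.range y) → s ≠ (y i) → dist s (y i) < 13 / 10 * d + γ → dist s (y i) ≤ 13 / 10 * d - γ ∧ s ∈ Set.range t)))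

/-- Dropping the cap. [folklore] -/
theorem GoodAtScale.goodAt {η D : ℝ} {N : ℕ} {y : Fin N → E3} {i : Fin N} (h : GoodAtScale η D y i) : GoodAt η y i := by
  obtain ⟨d, η', γ, A, -, hor⟩ := h
  exact ⟨d, η', γ, A, hor⟩

/-- The fit scale of the two-shell predicate IS the nearest-neighbour distance (injective cluster): from the two pinning clauses. [folklore] -/
theorem scale_eq_nearestDist {N : ℕ} {y : Fin N → E3} (hy : Function.Injective y) {i : Fin N} {d : ℝ}
    (h1 : ∀ s : E3, s ∈ Set.range y → s ≠ y i → d ≤ dist s (y i)) (h2 : ∃ s : E3, s ∈ Set.range y ∧ s ≠ y i ∧ dist s (y i) ≤ d) :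
    d = nearestDist y i := by
  obtain ⟨s, ⟨k, rfl⟩, hki, hk⟩ := h2
  have hk' : k ≠ i := fun h => hki (congrArg y h)
  refine le_antisymm (le_nearestDist ⟨k, hk'⟩ fun j hj => ?_) ?_
  · rw [dist_comm]; exact h1 (y j) ⟨j, rfl⟩ (hy.ne hj)
  · rw [dist_comm] at hk; exact (nearestDist_le_dist y hk').trans hk

/-- ★ `GoodAtScale η D y i ↔ GoodAt η y i ∧ nearestDist y i ≤ D` (injective `y`). [folklore] -/
theorem goodAtScale_iff {η D : ℝ} {N : ℕ} {y : Fin N → E3} (hy : Function.Injective y) {i : Fin N} :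
    GoodAtScale η D y i ↔ GoodAt η y i ∧ nearestDist y i ≤ D := by
  constructor
  · rintro ⟨d, η', γ, A, hdD, hor⟩
    refine ⟨⟨d, η', γ, A, hor⟩, ?_⟩
    rcases hor with ⟨t, -, -, -, -, h1, h2, -⟩ | ⟨t, -, -, -, -, h1, h2, -⟩
    · rwa [← scale_eq_nearestDist hy h1 h2]
    · rwa [← scale_eq_nearestDist hy h1 h2]
  · rintro ⟨⟨d, η', γ, A, hor⟩, hD⟩
    refine ⟨d, η', γ, A, ?_, hor⟩
    rcases hor with ⟨t, -, -, -, -, h1, h2, -⟩ | ⟨t, -, -, -, -, h1, h2, -⟩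
    · rwa [scale_eq_nearestDist hy h1 h2]
    · rwa [scale_eq_nearestDist hy h1 h2]

/-! ## §2. Extension from a deep sub-cluster: a capped-good centre of the motif is good in the cluster -/

/-- The clause list of the fit predicate EXTENDS from a point set `Xz` to a superset `Xy` that adds no point within `ϱ` of the centre, provided
the shell is deep (`13/10·d + 1 ≤ ϱ`); the clean gap is capped at `1`.  Generic in the pattern type (sub-cluster twin of
`…LocalCloseOrderFinite.robustGood_of_deep`). [folklore] -/
theorem clauses_extend {P : Type*} (v : P → E3) {Xz Xy : Set E3} {p : E3} {ϱ d η' ηmax γ : ℝ} {A : E3 →ₗᵢ[ℝ] E3} {t : P → E3}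
    (hsub : Xz ⊆ Xy) (hball : ∀ s ∈ Xy, dist s p ≤ ϱ → s ∈ Xz) (hdeep : 13 / 10 * d + 1 ≤ ϱ)
    (h : 0 < d ∧ 0 < γ ∧ η' < ηmax ∧ (∀ u, t u ∈ Xz ∧ ‖(t u - p) - d • A (v u)‖ ≤ η' * d) ∧ (∀ s, s ∈ Xz → s ≠ p → d ≤ dist s p) ∧
      (∃ s, s ∈ Xz ∧ s ≠ p ∧ dist s p ≤ d) ∧ (∀ s, s ∈ Xz → s ≠ p → dist s p < 13 / 10 * d + γ → dist s p ≤ 13 / 10 * d - γ ∧ s ∈ Set.range t)) :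
    0 < d ∧ 0 < min γ 1 ∧ η' < ηmax ∧ (∀ u, t u ∈ Xy ∧ ‖(t u - p) - d • A (v u)‖ ≤ η' * d) ∧ (∀ s, s ∈ Xy → s ≠ p → d ≤ dist s p) ∧
      (∃ s, s ∈ Xy ∧ s ≠ p ∧ dist s p ≤ d) ∧
      (∀ s, s ∈ Xy → s ≠ p → dist s p < 13 / 10 * d + min γ 1 → dist s p ≤ 13 / 10 * d - min γ 1 ∧ s ∈ Set.range t) := by
  obtain ⟨hd, hγ, hη, ht, hnn₁, hnn₂, hgap⟩ := h
  have hγ1 : min γ 1 ≤ γ := min_le_left _ _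
  have h1le : min γ 1 ≤ 1 := min_le_right _ _
  refine ⟨hd, lt_min hγ one_pos, hη, fun u => ⟨hsub (ht u).1, (ht u).2⟩, fun s hs hsp => ?_, ?_, fun s hs hsp hlt => ?_⟩
  · by_cases hle : dist s p ≤ ϱ
    · exact hnn₁ s (hball s hs hle) hsp
    · push Not at hle
      nlinarith
  · obtain ⟨s, hs, hsp, hle⟩ := hnn₂
    exact ⟨s, hsub hs, hsp, hle⟩
  · have hsz : s ∈ Xz := hball s hs (by linarith)
    obtain ⟨h1, h2⟩ := hgap s hsz hsp (by linarith)
    exact ⟨by linarith, h2⟩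

/-- ★ **A CAPPED-GOOD CENTRE OF A DEEP MOTIF IS GOOD IN THE CLUSTER**: `z = y ∘ φ` a sub-cluster (`φ` injective) containing every atom of `y` within
`ϱ` of `y (φ c)`, `13/10·D + 1 ≤ ϱ`; then `GoodAtScale η D z c → GoodAt η y (φ c)`. [folklore] -/
theorem goodAt_of_motif {η D ϱ : ℝ} {N M : ℕ} {y : Fin N → E3} {φ : Fin M → Fin N} {c : Fin M}
    (hS : ∀ k : Fin N, dist (y k) (y (φ c)) ≤ ϱ → k ∈ Set.range φ) (hdeep : 13 / 10 * D + 1 ≤ ϱ)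
    (h : GoodAtScale η D (y ∘ φ) c) : GoodAt η y (φ c) := by
  obtain ⟨d, η', γ, A, hdD, hor⟩ := h
  have hsub : Set.range (y ∘ φ) ⊆ Set.range y := Set.range_comp_subset_range φ y
  have hball : ∀ s ∈ Set.range y, dist s (y (φ c)) ≤ ϱ → s ∈ Set.range (y ∘ φ) := by
    rintro s ⟨k, rfl⟩ hk
    obtain ⟨a, ha⟩ := hS k hk
    exact ⟨a, by simp [ha]⟩
  have hp : (y ∘ φ) c = y (φ c) := rfl
  rw [hp] at hor
  refine ⟨d, η', min γ 1, A, ?_⟩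
  rcases hor with ⟨t, h⟩ | ⟨t, h⟩
  · have hdeep' : 13 / 10 * d + 1 ≤ ϱ := by have := h.1; nlinarith
    exact Or.inl ⟨t, clauses_extend (fun u : ↥Literature.Geometry.DiscreteGeometry.fccKissingPattern => (u : E3)) hsub hball hdeep' h⟩
  · have hdeep' : 13 / 10 * d + 1 ≤ ϱ := by have := h.1; nlinarith
    exact Or.inr ⟨t, clauses_extend (fun u : ↥Literature.Geometry.DiscreteGeometry.hcpKissingPattern => (u : E3)) hsub hball hdeep' h⟩

/-! ## §3. The motif of a site and the agreement of the three site quantities -/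

/-- Sums over a sub-cluster enumerated by an order embedding with range `S` are sums over `S`. [folklore] -/
theorem sum_orderEmb {N M : ℕ} {S : Finset (Fin N)} (φ : Fin M ↪o Fin N) (hφ : Set.range φ = ↑S) (f : Fin N → ℝ) :
    ∑ a : Fin M, f (φ a) = ∑ j ∈ S, f j := by
  have hmap : (Finset.univ : Finset (Fin M)).map φ.toEmbedding = S := by
    apply Finset.coe_injective
    rw [Finset.coe_map, Finset.coe_univ, Set.image_univ]
    exact hφ
  rw [← hmap, Finset.sum_map]
  rfl

/-- A sum over all sites of a function vanishing off `S` is the sum over `S`. [folklore] -/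
theorem sum_eq_sum_of_vanish {N : ℕ} (S : Finset (Fin N)) (f : Fin N → ℝ) (hf : ∀ j, j ∉ S → f j = 0) :
    ∑ j, f j = ∑ j ∈ S, f j :=
  (Finset.sum_subset (Finset.subset_univ S) fun j _ hj => hf j hj).symm

/-- `truncLJ R r = 0` for `r ≥ R`. [folklore] -/
theorem truncLJ_of_le {R r : ℝ} (h : R ≤ r) : truncLJ R r = 0 := by
  unfold truncLJ
  rw [if_neg (not_lt.mpr h)]

/-- **Nearest-neighbour distance of the centre agrees** between the cluster and a sub-cluster containing every atom within `ϱ` of the centre, as soon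
as some OTHER atom lies within `ϱ`. [folklore] -/
theorem nearestDist_motif {ϱ : ℝ} {N M : ℕ} {y : Fin N → E3} {φ : Fin M → Fin N} (hφ : Function.Injective φ)
    {c : Fin M} (hS : ∀ k : Fin N, dist (y k) (y (φ c)) ≤ ϱ → k ∈ Set.range φ)
    (hne : ∃ k : Fin N, k ≠ φ c ∧ dist (y k) (y (φ c)) ≤ ϱ) :
    nearestDist (y ∘ φ) c = nearestDist y (φ c) := by
  obtain ⟨k, hk, hkϱ⟩ := hne
  obtain ⟨a₁, ha₁⟩ := hS k hkϱ
  have ha₁c : a₁ ≠ c := fun h => hk (by rw [← ha₁, h])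
  refine le_antisymm ?_ ?_
  · -- the cluster's nearest neighbour lies within `ϱ`, hence in the motif
    have hN : ∃ k, k ≠ φ c := ⟨k, hk⟩
    obtain ⟨k₀, hk₀, hk₀d⟩ := exists_nearestDist_eq_dist y hN
    have hk₀ϱ : dist (y k₀) (y (φ c)) ≤ ϱ := by
      rw [dist_comm, ← hk₀d]
      exact (nearestDist_le_dist y hk).trans (by rwa [dist_comm])
    obtain ⟨a₀, ha₀⟩ := hS k₀ hk₀ϱ
    have ha₀c : a₀ ≠ c := fun h => hk₀ (by rw [← ha₀, h])
    calc nearestDist (y ∘ φ) c ≤ dist ((y ∘ φ) c) ((y ∘ φ) a₀) := nearestDist_le_dist (y ∘ φ) ha₀c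
      _ = nearestDist y (φ c) := by simp [ha₀, hk₀d]
  · have hM : ∃ a, a ≠ c := ⟨a₁, ha₁c⟩
    refine le_nearestDist hM fun a ha => ?_
    exact nearestDist_le_dist y (fun h => ha (hφ h))

/-- Hence the density proxies agree. [folklore] -/
theorem densityProxy_motif {ϱ : ℝ} {N M : ℕ} {y : Fin N → E3} {φ : Fin M → Fin N} (hφ : Function.Injective φ)
    {c : Fin M} (hS : ∀ k : Fin N, dist (y k) (y (φ c)) ≤ ϱ → k ∈ Set.range φ)
    (hne : ∃ k : Fin N, k ≠ φ c ∧ dist (y k) (y (φ c)) ≤ ϱ) :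
    densityProxy (y ∘ φ) c = densityProxy y (φ c) := by
  unfold densityProxy
  rw [nearestDist_motif hφ hS hne]

/-- **The truncated site sum agrees** (`R ≤ ϱ`). [folklore] -/
theorem truncSum_motif {R ϱ : ℝ} (hR : R ≤ ϱ) {N M : ℕ} {y : Fin N → E3} {S : Finset (Fin N)} (φ : Fin M ↪o Fin N)
    (hφ : Set.range φ = ↑S) {c : Fin M} (hSdef : ∀ j, j ∈ S ↔ dist (y j) (y (φ c)) ≤ ϱ) :
    ∑ a : Fin M, truncLJ R (dist ((y ∘ φ) c) ((y ∘ φ) a)) = ∑ j, truncLJ R (dist (y (φ c)) (y j)) := by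
  rw [sum_eq_sum_of_vanish S (fun j => truncLJ R (dist (y (φ c)) (y j))) fun j hj => ?_]
  · exact sum_orderEmb φ hφ (fun j => truncLJ R (dist (y (φ c)) (y j)))
  · have : ϱ < dist (y j) (y (φ c)) := lt_of_not_ge fun h => hj ((hSdef j).2 h)
    rw [dist_comm] at this
    exact truncLJ_of_le (by linarith)

/-- **The net inflow of the centre agrees** for a rule of range `R′` and locality `ρ` with `R′ + ρ ≤ ϱ`, `ρ ≤ ϱ`, `R′ ≤ ϱ`. [folklore] -/
theorem netInflow_motif {R' ρ ϱ : ℝ} {F : TransferRule} (hF₁ : HasRange R' F) (hF₂ : IsLocal ρ F) (hRρ : R' + ρ ≤ ϱ) (hρ : ρ ≤ ϱ)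
    (hR' : R' ≤ ϱ) {N M : ℕ} {y : Fin N → E3} {S : Finset (Fin N)} (φ : Fin M ↪o Fin N) (hφ : Set.range φ = ↑S) {c : Fin M}
    (hSdef : ∀ j, j ∈ S ↔ dist (y j) (y (φ c)) ≤ ϱ) :
    netInflow F M (y ∘ φ) c = netInflow F N y (φ c) := by
  have hφinj : Function.Injective φ := φ.injective
  -- pointwise agreement on the motif
  have key : ∀ a : Fin M, F M (y ∘ φ) a c = F N y (φ a) (φ c) ∧ F M (y ∘ φ) c a = F N y (φ c) (φ a) := by
    intro a
    by_cases hd : dist (y (φ a)) (y (φ c)) ≤ R'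
    · have hloc : ∀ k : Fin N, dist (y k) (y (φ a)) ≤ ρ ∨ dist (y k) (y (φ c)) ≤ ρ → k ∈ Set.range φ := by
        intro k hk
        have hkS : k ∈ S := by
          rw [hSdef]
          rcases hk with hk | hk
          · calc dist (y k) (y (φ c)) ≤ dist (y k) (y (φ a)) + dist (y (φ a)) (y (φ c)) := dist_triangle _ _ _
              _ ≤ ρ + R' := add_le_add hk hd
              _ ≤ ϱ := by linarith
          · exact hk.trans hρ
        have : k ∈ (↑S : Set (Fin N)) := hkS
        rwa [← hφ] at this
      have hloc' : ∀ k : Fin N, dist (y k) (y (φ c)) ≤ ρ ∨ dist (y k) (y (φ a)) ≤ ρ → k ∈ Set.range φ :=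
        fun k hk => hloc k hk.symm
      exact ⟨hF₂ N M y φ hφinj a c hloc, hF₂ N M y φ hφinj c a hloc'⟩
    · push Not at hd
      have hd' : R' < dist ((y ∘ φ) a) ((y ∘ φ) c) := hd
      have hd'' : R' < dist (y (φ c)) (y (φ a)) := by rw [dist_comm]; exact hd
      refine ⟨?_, ?_⟩
      · rw [hF₁ M (y ∘ φ) a c hd', hF₁ N y (φ a) (φ c) hd]
      · rw [hF₁ M (y ∘ φ) c a (by rw [dist_comm] at hd'; exact hd'), hF₁ N y (φ c) (φ a) hd'']
  unfold netInflow
  have h1 : ∑ a : Fin M, F M (y ∘ φ) a c = ∑ j, F N y j (φ c) := by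
    rw [sum_eq_sum_of_vanish S (fun j => F N y j (φ c)) fun j hj => ?_]
    · rw [← sum_orderEmb φ hφ (fun j => F N y j (φ c))]
      exact Finset.sum_congr rfl fun a _ => (key a).1
    · have : ϱ < dist (y j) (y (φ c)) := lt_of_not_ge fun h => hj ((hSdef j).2 h)
      exact hF₁ N y j (φ c) (by linarith)
  have h2 : ∑ a : Fin M, F M (y ∘ φ) c a = ∑ j, F N y (φ c) j := by
    rw [sum_eq_sum_of_vanish S (fun j => F N y (φ c) j) fun j hj => ?_]
    · rw [← sum_orderEmb φ hφ (fun j => F N y (φ c) j)]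
      exact Finset.sum_congr rfl fun a _ => (key a).2
    · have : ϱ < dist (y j) (y (φ c)) := lt_of_not_ge fun h => hj ((hSdef j).2 h)
      exact hF₁ N y (φ c) j (by rw [dist_comm]; linarith)
  rw [h1, h2]

/-- **An isolated site** (no other atom within `ϱ ≥ max (R, R′, 1)`): truncated site sum `0`, net inflow `0`, density proxy `∈ {0, 1}`, so its
right-hand side is `≥ −A` (`A ≥ 0`). [folklore] -/
theorem rhs_ge_of_isolated {R R' ϱ A : ℝ} {F : TransferRule} (hF₁ : HasRange R' F) (hR : R ≤ ϱ) (hR' : R' ≤ ϱ) (h1 : 1 ≤ ϱ) (hA : 0 ≤ A)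
    {N : ℕ} {y : Fin N → E3} {i : Fin N} (hiso : ∀ k : Fin N, k ≠ i → ϱ < dist (y k) (y i)) :
    -A ≤ (∑ j, truncLJ R (dist (y i) (y j))) / 2 - A * densityProxy y i + netInflow F N y i := by
  have hsum : ∑ j, truncLJ R (dist (y i) (y j)) = 0 := by
    refine Finset.sum_eq_zero fun j _ => ?_
    by_cases hj : j = i
    · subst hj; simp [truncLJ_zero]
    · exact truncLJ_of_le (by have := hiso j hj; rw [dist_comm] at this; linarith)
  have hflow : netInflow F N y i = 0 := by
    unfold netInflow
    rw [← Finset.sum_sub_distrib]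
    refine Finset.sum_eq_zero fun j _ => ?_
    by_cases hj : j = i
    · subst hj; simp
    · have hd := hiso j hj
      rw [hF₁ N y j i (by linarith), hF₁ N y i j (by rw [dist_comm]; linarith), sub_self]
  have hm : densityProxy y i ≤ 1 := by
    unfold densityProxy
    by_cases hN : ∃ k, k ≠ i
    · have hnn : 1 ≤ nearestDist y i := le_nearestDist hN fun k hk => by
        have := hiso k hk; rw [dist_comm] at this; linarith
      rw [min_eq_right hnn]; norm_num
    · push Not at hN
      haveI : Subsingleton (Fin N) := ⟨fun a b => by rw [hN a, hN b]⟩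
      rw [nearestDist_eq_zero_of_subsingleton]; norm_num
  rw [hsum, hflow]
  nlinarith [densityProxy_nonneg y i]

/-- Indicator comparison from an implication. [folklore] -/
theorem ite_le_ite_of_imp {P Q : Prop} (h : P → Q) : (if P then (1 : ℝ) else 0) ≤ (if Q then (1 : ℝ) else 0) := by
  by_cases hP : P
  · rw [if_pos hP, if_pos (h hP)]
  · rw [if_neg hP]; split_ifs <;> norm_num

end Summit.AtomisticToContinuum.Crystallization.Theorems.FrustratedLawDichotomyMotifLemmas

end
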